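import Mathlib
import Summits.Ventures.PercRepro2.TB14CutCase2
import Summits.Ventures.PercRepro2.TB14SeriesConn

/-!
# The series rule for typed BHK 1.4: an unmarked vertex of degree two
(blind cell PercRepro2, mine-c g15, 2026-08-25; `proofs/MINEC-TB14BLOCK.md` Theorem D)

Let `w ∉ {a₁, a₂, b, o}` have exactly two edges `e₁ = w u`, `e₂ = w v`, both free.  Splitting the
two-copy count on the colours of `e₁, e₂`: the two MONOCHROMATIC colourings are the two colourings
of a single free edge `u v` (the path `u – w – v` in one colour, `w` isolated in the other), and the
two MIXED colourings make `w` a leaf in each colour — a spectator.  Hence (`tb14_series`)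

  `D(G) = D(G − w + uv) + 2 · D(G − w)`

where `G − w + uv` reroutes `e₁` to `u v` and closes `e₂`, and `G − w` closes both.  With the
cut-vertex reduction this shrinks the open part of row 2′TB to the 2-connected instances in which
every unmarked vertex has degree ≥ 3.  Own work; standard axioms.
-/

namespace Summit.Ventures.PercRepro2

namespace TB14Cut

open CovForm A3InactiveTyped

section Split

variable {E : Type*} [Fintype E] [DecidableEq E] {R : Type*} [CommRing R]

omit [Fintype E] in
/-- Admissibility for `(F.erase e, z[e ↦ false])` is admissibility for `(F, z)` together with
`y e = false`. -/
lemma admissible_erase_iff {F : Finset E} {z : Config E} {e : E} (he : e ∈ F) (y : Config E) :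
    (∀ f, f ∉ F.erase e → y f = Function.update z e false f) ↔
      ((∀ f, f ∉ F → y f = z f) ∧ y e = false) := by
  constructor
  · intro h
    refine ⟨fun f hf => ?_, ?_⟩
    · have hfe : f ≠ e := fun hfe => hf (hfe ▸ he)
      have := h f (fun h' => hf (Finset.mem_of_mem_erase h'))
      rwa [Function.update_of_ne hfe] at this
    · have := h e (fun h' => (Finset.mem_erase.1 h').1 rfl)
      rwa [Function.update_self] at this
  · rintro ⟨h, he'⟩ f hf
    by_cases hfe : f = e
    · subst hfe
      rw [Function.update_self]
      exact he'
    · rw [Function.update_of_ne hfe]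
      exact h f (fun h' => hf (Finset.mem_erase.2 ⟨hfe, h'⟩))

omit [Fintype E] in
/-- Flipping a free edge preserves admissibility. -/
lemma admissible_flipEdge_iff {F : Finset E} {z : Config E} {e : E} (he : e ∈ F) (y : Config E) :
    (∀ f, f ∉ F → flipEdge e y f = z f) ↔ (∀ f, f ∉ F → y f = z f) := by
  constructor
  · intro h f hf
    have hfe : f ≠ e := fun hfe => hf (hfe ▸ he)
    rw [← flipEdge_apply_of_ne hfe y]
    exact h f hf
  · intro h f hf
    have hfe : f ≠ e := fun hfe => hf (hfe ▸ he)
    rw [flipEdge_apply_of_ne hfe y]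
    exact h f hf

/-- **Splitting a two-copy sum on a free edge**: the admissible configurations of `(F, z)` are the
admissible configurations of `(F.erase e, z[e ↦ false])` with `e` set either way. -/
lemma sum_admissible_split {F : Finset E} {z : Config E} {e : E} (he : e ∈ F)
    (g : Config E → R) :
    (∑ y : Config E, if (∀ f, f ∉ F → y f = z f) then g y else 0) =
      ∑ y : Config E, if (∀ f, f ∉ F.erase e → y f = Function.update z e false f) then
        g (Function.update y e false) + g (Function.update y e true) else 0 := by
  have hsplit : ∀ y : Config E, (if (∀ f, f ∉ F → y f = z f) then g y else 0) =
      (if (∀ f, f ∉ F → y f = z f) ∧ y e = false then g y else 0) +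
        (if (∀ f, f ∉ F → y f = z f) ∧ y e = true then g y else 0) := by
    intro y
    by_cases hadm : ∀ f, f ∉ F → y f = z f
    · rw [if_pos hadm]
      by_cases hye : y e = false
      · rw [if_pos ⟨hadm, hye⟩, if_neg (fun h => Bool.false_ne_true (hye ▸ h.2)), add_zero]
      · have hye' : y e = true := by simpa using hye
        rw [if_neg (fun h => hye h.2), if_pos ⟨hadm, hye'⟩, zero_add]
    · rw [if_neg hadm, if_neg (fun h => hadm h.1), if_neg (fun h => hadm h.1), add_zero]
  simp_rw [hsplit]
  rw [Finset.sum_add_distrib]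
  have h2 : (∑ y : Config E, if (∀ f, f ∉ F → y f = z f) ∧ y e = true then g y else 0) =
      ∑ y : Config E, if (∀ f, f ∉ F → y f = z f) ∧ y e = false then
        g (Function.update y e true) else 0 := by
    rw [← sum_flipEdge e]
    refine Finset.sum_congr rfl fun y _ => ?_
    by_cases hadm : ∀ f, f ∉ F → y f = z f
    · by_cases hye : y e = false
      · have hf : flipEdge e y e = true := by rw [flipEdge_apply_self, hye]; rfl
        rw [if_pos ⟨(admissible_flipEdge_iff he y).2 hadm, hf⟩, if_pos ⟨hadm, hye⟩]
        congr 1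
        funext f
        by_cases hfe : f = e
        · subst hfe; simp [hye]
        · simp [flipEdge_apply_of_ne hfe, Function.update_of_ne hfe]
      · have hye' : y e = true := by simpa using hye
        have hf : flipEdge e y e = false := by rw [flipEdge_apply_self, hye']; rfl
        rw [if_neg (fun h => Bool.false_ne_true (hf ▸ h.2)), if_neg (fun h => hye h.2)]
    · rw [if_neg (fun h => hadm ((admissible_flipEdge_iff he y).1 h.1)), if_neg (fun h => hadm h.1)]
  rw [h2, ← Finset.sum_add_distrib]
  refine Finset.sum_congr rfl fun y _ => ?_
  by_cases h : (∀ f, f ∉ F → y f = z f) ∧ y e = false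
  · rw [if_pos h, if_pos h, if_pos ((admissible_erase_iff he y).2 h)]
    congr 2
    funext f
    by_cases hfe : f = e
    · subst hfe; simp [h.2]
    · simp [Function.update_of_ne hfe]
  · rw [if_neg h, if_neg h, if_neg (fun h' => h ((admissible_erase_iff he y).1 h')), add_zero]

end Split

/-! ## The series rule -/

section Series

variable {V : Type} {E : Type} [Fintype E] [DecidableEq E] {R : Type*} [Field R]

/-- The folded (TB14) kernel of the marking `(a₁, a₂, b, o)` on the graph `ends`:
`1_Q(y) 1_Q(w) 1[b ∈ C_y(a₁)] (1[o ∈ C_w(a₂)] − 1[o ∈ C_y(a₂)])`. -/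
noncomputable def foldK (ends : E → Sym2 V) (a₁ a₂ b o : V) : Config E → Config E → R :=
  fun y w => iQ ends a₁ a₂ y * iQ ends a₁ a₂ w * iL ends a₁ b y * (iH ends a₂ o w - iH ends a₂ o y)

/-- The (TB14) slack is the two-copy count of the folded kernel. -/
lemma slack_eq_pairCount_foldK (ends : E → Sym2 V) (a₁ a₂ b o : V) (F : Finset E)
    (z : Config E) :
    pairCount F z (crossBO ends a₁ a₂ b o : Config E → Config E → R) -
        pairCount F z (sameBO ends a₁ a₂ b o) =
      pairCount F z (foldK ends a₁ a₂ b o) := by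
  classical
  exact tb14_slack_eq ends a₁ a₂ b o F z

omit [Fintype E] [DecidableEq E] in
/-- The folded kernel only sees the connections among the four marks. -/
lemma foldK_congr {ends ends' : E → Sym2 V} {a₁ a₂ b o w : V} {y y' w₁ w₁' : Config E}
    (ha₁ : a₁ ≠ w) (ha₂ : a₂ ≠ w) (hb : b ≠ w) (ho : o ≠ w)
    (h1 : ∀ x x' : V, x ≠ w → x' ≠ w → (Conn ends y x x' ↔ Conn ends' y' x x'))
    (h2 : ∀ x x' : V, x ≠ w → x' ≠ w → (Conn ends w₁ x x' ↔ Conn ends' w₁' x x')) :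
    (foldK ends a₁ a₂ b o y w₁ : R) = foldK ends' a₁ a₂ b o y' w₁' := by
  classical
  simp only [foldK, iQ_eq_ite', iL_eq_ite', iH_eq_ite', h1 a₁ a₂ ha₁ ha₂, h1 a₁ b ha₁ hb,
    h1 a₂ o ha₂ ho, h2 a₁ a₂ ha₁ ha₂, h2 a₂ o ha₂ ho]

variable {ends : E → Sym2 V} {e₁ e₂ : E} {w u v : V}

omit [Fintype E] [DecidableEq E] in
/-- Connectivity off `w` is the same in two configurations which agree off `{e₁, e₂}` when
`e₁, e₂` are closed in both (the graphs may differ at `e₁`). -/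
lemma conn_closed_pair {ends' : E → Sym2 V} (hends : ∀ f, f ≠ e₁ → ends' f = ends f)
    {y y' : Config E} (hy : y e₁ = false) (hy₂ : y e₂ = false) (hy' : y' e₁ = false)
    (hy₂' : y' e₂ = false) (hagree : ∀ f, f ≠ e₁ → f ≠ e₂ → y f = y' f) (x x' : V) :
    Conn ends y x x' ↔ Conn ends' y' x x' := by
  refine conn_congr_open ?_ ?_ x x'
  · intro f hf
    have hf₁ : f ≠ e₁ := fun h => by subst h; rw [hy] at hf; exact Bool.false_ne_true hf
    have hf₂ : f ≠ e₂ := fun h => by subst h; rw [hy₂] at hf; exact Bool.false_ne_true hf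
    exact ⟨by rw [← hagree f hf₁ hf₂]; exact hf, hends f hf₁⟩
  · intro f hf
    have hf₁ : f ≠ e₁ := fun h => by subst h; rw [hy'] at hf; exact Bool.false_ne_true hf
    have hf₂ : f ≠ e₂ := fun h => by subst h; rw [hy₂'] at hf; exact Bool.false_ne_true hf
    exact ⟨by rw [hagree f hf₁ hf₂]; exact hf, (hends f hf₁).symm⟩

/-- **The series rule** (THEOREM): for an unmarked vertex `w` whose only edges are the free edges
`e₁ = w u` and `e₂ = w v`, the two-copy count of the folded kernel satisfies
`N(G) = N(G − w + uv) + 2 · N(G − w)`, where `G − w + uv` reroutes `e₁` to `u v` and closes `e₂`,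
and `G − w` closes both. -/
theorem pairCount_foldK_series (he : e₁ ≠ e₂) (h₁ : ends e₁ = s(w, u)) (h₂ : ends e₂ = s(w, v))
    (hwu : w ≠ u) (hwv : w ≠ v) (hw : ∀ f, w ∈ ends f → f = e₁ ∨ f = e₂) {a₁ a₂ b o : V}
    (ha₁ : a₁ ≠ w) (ha₂ : a₂ ≠ w) (hb : b ≠ w) (ho : o ≠ w) (F : Finset E) (z : Config E)
    (h₁F : e₁ ∈ F) (h₂F : e₂ ∈ F) :
    pairCount F z (foldK ends a₁ a₂ b o : Config E → Config E → R) =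
      pairCount (F.erase e₂) (Function.update z e₂ false)
          (foldK (Function.update ends e₁ s(u, v)) a₁ a₂ b o) +
        2 * pairCount ((F.erase e₂).erase e₁) (Function.update (Function.update z e₂ false) e₁ false)
          (foldK ends a₁ a₂ b o) := by
  set ends' := Function.update ends e₁ s(u, v) with hends'
  set F' := F.erase e₂ with hF'
  set z' := Function.update z e₂ false with hz'
  have h₁F' : e₁ ∈ F' := Finset.mem_erase.2 ⟨he, h₁F⟩
  have hends'_ne : ∀ f, f ≠ e₁ → ends' f = ends f := fun f hf => by
    rw [hends', Function.update_of_ne hf]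
  -- the two pointwise identities, for an admissible `y₁` of `(F', z')` (so `y₁ e₂ = false`)
  have hmono : ∀ y₁ : Config E, y₁ e₂ = false →
      (foldK ends a₁ a₂ b o (Function.update y₁ e₂ (y₁ e₁))
          (A3InactiveTyped.flipOn F (Function.update y₁ e₂ (y₁ e₁))) : R) =
        foldK ends' a₁ a₂ b o y₁ (A3InactiveTyped.flipOn F' y₁) := by
    intro y₁ hy₁₂
    cases hy₁₁ : y₁ e₁
    · -- both closed in the first copy; both open in the second
      have hy : Function.update y₁ e₂ false = y₁ := by
        rw [← hy₁₂]; exact Function.update_eq_self e₂ y₁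
      rw [hy]
      refine foldK_congr ha₁ ha₂ hb ho ?_ ?_
      · intro x x' _ _
        refine conn_closed_pair (e₂ := e₂) hends'_ne hy₁₁ hy₁₂ hy₁₁ hy₁₂ (fun f _ _ => rfl) x x'
      · intro x x' hx hx'
        have hf₁ : A3InactiveTyped.flipOn F y₁ e₁ = true := by
          rw [A3InactiveTyped.flipOn_of_mem h₁F, hy₁₁]; rfl
        have hf₂ : A3InactiveTyped.flipOn F y₁ e₂ = true := by
          rw [A3InactiveTyped.flipOn_of_mem h₂F, hy₁₂]; rfl
        rw [conn_series he h₁ h₂ hwu hwv hw hf₁ hf₂ hx hx']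
        have hupd : Function.update (A3InactiveTyped.flipOn F y₁) e₂ false =
            A3InactiveTyped.flipOn F' y₁ := by
          funext f
          by_cases hfe : f = e₂
          · subst hfe
            rw [Function.update_self, A3InactiveTyped.flipOn_of_notMem (Finset.notMem_erase f F)]
            exact hy₁₂.symm
          · rw [Function.update_of_ne hfe]
            by_cases hfF : f ∈ F
            · rw [A3InactiveTyped.flipOn_of_mem hfF,
                A3InactiveTyped.flipOn_of_mem (Finset.mem_erase.2 ⟨hfe, hfF⟩)]
            · rw [A3InactiveTyped.flipOn_of_notMem hfF,
                A3InactiveTyped.flipOn_of_notMem (fun h => hfF (Finset.mem_of_mem_erase h))]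
        rw [hupd]
    · -- both open in the first copy; both closed in the second
      refine foldK_congr ha₁ ha₂ hb ho ?_ ?_
      · intro x x' hx hx'
        have hy₁ : Function.update y₁ e₂ true e₁ = true := by
          rw [Function.update_of_ne he]; exact hy₁₁
        have hy₂ : Function.update y₁ e₂ true e₂ = true := Function.update_self _ _ _
        rw [conn_series he h₁ h₂ hwu hwv hw hy₁ hy₂ hx hx']
        have hupd : Function.update (Function.update y₁ e₂ true) e₂ false = y₁ := by
          rw [Function.update_idem, ← hy₁₂]; exact Function.update_eq_self e₂ y₁
        rw [hupd]
      · intro x x' _ _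
        refine conn_closed_pair (e₂ := e₂) hends'_ne ?_ ?_ ?_ ?_ ?_ x x'
        · rw [A3InactiveTyped.flipOn_of_mem h₁F, Function.update_of_ne he, hy₁₁]; rfl
        · rw [A3InactiveTyped.flipOn_of_mem h₂F, Function.update_self]; rfl
        · rw [A3InactiveTyped.flipOn_of_mem h₁F', hy₁₁]; rfl
        · rw [A3InactiveTyped.flipOn_of_notMem (Finset.notMem_erase e₂ F)]; exact hy₁₂
        · intro f hf₁ hf₂
          by_cases hfF : f ∈ F
          · rw [A3InactiveTyped.flipOn_of_mem hfF,
              A3InactiveTyped.flipOn_of_mem (Finset.mem_erase.2 ⟨hf₂, hfF⟩),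
              Function.update_of_ne hf₂]
          · rw [A3InactiveTyped.flipOn_of_notMem hfF,
              A3InactiveTyped.flipOn_of_notMem (fun h => hfF (Finset.mem_of_mem_erase h)),
              Function.update_of_ne hf₂]
  set F'' := F'.erase e₁ with hF''
  set z'' := Function.update z' e₁ false with hz''
  have hw₁ : ∀ f, w ∈ ends f → f ≠ e₁ → f = e₂ := fun f hf hf₁ => (hw f hf).resolve_left hf₁
  have hw₂ : ∀ f, w ∈ ends f → f ≠ e₂ → f = e₁ := fun f hf hf₂ => (hw f hf).resolve_right hf₂
  -- mixed, `e₁` closed and `e₂` open in the first copy (`w` a leaf at `v`)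
  have hmixF : ∀ y₁ : Config E, y₁ e₂ = false → y₁ e₁ = false →
      (foldK ends a₁ a₂ b o (Function.update y₁ e₂ true)
          (A3InactiveTyped.flipOn F (Function.update y₁ e₂ true)) : R) =
        foldK ends a₁ a₂ b o (Function.update y₁ e₁ false)
          (A3InactiveTyped.flipOn F'' (Function.update y₁ e₁ false)) := by
    intro y₁ hy₁₂ hy₁₁
    have hy'' : Function.update y₁ e₁ false = y₁ := by
      rw [← hy₁₁]; exact Function.update_eq_self e₁ y₁
    rw [hy'']
    refine foldK_congr ha₁ ha₂ hb ho ?_ ?_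
    · intro x x' hx hx'
      have hleaf : ∀ f, w ∈ ends f → f ≠ e₂ → Function.update y₁ e₂ true f = false := by
        intro f hf hf₂
        rw [Function.update_of_ne hf₂, hw₂ f hf hf₂]; exact hy₁₁
      rw [conn_leaf_erase h₂ hwv hleaf (Function.update_self _ _ _) hx hx']
      have hupd : Function.update (Function.update y₁ e₂ true) e₂ false = y₁ := by
        rw [Function.update_idem, ← hy₁₂]; exact Function.update_eq_self e₂ y₁
      rw [hupd]
    · intro x x' hx hx'
      set yb := A3InactiveTyped.flipOn F (Function.update y₁ e₂ true) with hyb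
      have hyb₁ : yb e₁ = true := by
        rw [hyb, A3InactiveTyped.flipOn_of_mem h₁F, Function.update_of_ne he, hy₁₁]; rfl
      have hyb₂ : yb e₂ = false := by
        rw [hyb, A3InactiveTyped.flipOn_of_mem h₂F, Function.update_self]; rfl
      have hleaf : ∀ f, w ∈ ends f → f ≠ e₁ → yb f = false := by
        intro f hf hf₁
        rw [hw₁ f hf hf₁]; exact hyb₂
      rw [conn_leaf_erase h₁ hwu hleaf hyb₁ hx hx']
      have hupd : Function.update yb e₁ false = A3InactiveTyped.flipOn F'' y₁ := by
        funext f
        by_cases hf₁ : f = e₁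
        · subst hf₁
          rw [Function.update_self, A3InactiveTyped.flipOn_of_notMem (Finset.notMem_erase f F')]
          exact hy₁₁.symm
        by_cases hf₂ : f = e₂
        · subst hf₂
          rw [Function.update_of_ne hf₁, hyb₂,
            A3InactiveTyped.flipOn_of_notMem (fun h => Finset.notMem_erase f F
              (Finset.mem_of_mem_erase h))]
          exact hy₁₂.symm
        · rw [Function.update_of_ne hf₁, hyb]
          by_cases hfF : f ∈ F
          · rw [A3InactiveTyped.flipOn_of_mem hfF, Function.update_of_ne hf₂,
              A3InactiveTyped.flipOn_of_mem (Finset.mem_erase.2 ⟨hf₁, Finset.mem_erase.2 ⟨hf₂, hfF⟩⟩)]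
          · rw [A3InactiveTyped.flipOn_of_notMem hfF, Function.update_of_ne hf₂,
              A3InactiveTyped.flipOn_of_notMem (fun h => hfF
                (Finset.mem_of_mem_erase (Finset.mem_of_mem_erase h)))]
      rw [hupd]
  -- mixed, `e₁` open and `e₂` closed in the first copy (`w` a leaf at `u`)
  have hmixT : ∀ y₁ : Config E, y₁ e₂ = false → y₁ e₁ = true →
      (foldK ends a₁ a₂ b o (Function.update y₁ e₂ false)
          (A3InactiveTyped.flipOn F (Function.update y₁ e₂ false)) : R) =
        foldK ends a₁ a₂ b o (Function.update y₁ e₁ false)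
          (A3InactiveTyped.flipOn F'' (Function.update y₁ e₁ false)) := by
    intro y₁ hy₁₂ hy₁₁
    have hy : Function.update y₁ e₂ false = y₁ := by
      rw [← hy₁₂]; exact Function.update_eq_self e₂ y₁
    rw [hy]
    refine foldK_congr ha₁ ha₂ hb ho ?_ ?_
    · intro x x' hx hx'
      have hleaf : ∀ f, w ∈ ends f → f ≠ e₁ → y₁ f = false := by
        intro f hf hf₁
        rw [hw₁ f hf hf₁]; exact hy₁₂
      exact conn_leaf_erase h₁ hwu hleaf hy₁₁ hx hx'
    · intro x x' hx hx'
      set yb := A3InactiveTyped.flipOn F y₁ with hyb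
      have hyb₁ : yb e₁ = false := by
        rw [hyb, A3InactiveTyped.flipOn_of_mem h₁F, hy₁₁]; rfl
      have hyb₂ : yb e₂ = true := by
        rw [hyb, A3InactiveTyped.flipOn_of_mem h₂F, hy₁₂]; rfl
      have hleaf : ∀ f, w ∈ ends f → f ≠ e₂ → yb f = false := by
        intro f hf hf₂
        rw [hw₂ f hf hf₂]; exact hyb₁
      rw [conn_leaf_erase h₂ hwv hleaf hyb₂ hx hx']
      have hupd : Function.update yb e₂ false =
          A3InactiveTyped.flipOn F'' (Function.update y₁ e₁ false) := by
        funext f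
        by_cases hf₂ : f = e₂
        · subst hf₂
          rw [Function.update_self,
            A3InactiveTyped.flipOn_of_notMem (fun h => Finset.notMem_erase f F
              (Finset.mem_of_mem_erase h)), Function.update_of_ne he.symm]
          exact hy₁₂.symm
        by_cases hf₁ : f = e₁
        · subst hf₁
          rw [Function.update_of_ne hf₂, hyb₁,
            A3InactiveTyped.flipOn_of_notMem (Finset.notMem_erase f F'), Function.update_self]
        · rw [Function.update_of_ne hf₂, hyb]
          by_cases hfF : f ∈ F
          · rw [A3InactiveTyped.flipOn_of_mem hfF,
              A3InactiveTyped.flipOn_of_mem (Finset.mem_erase.2 ⟨hf₁, Finset.mem_erase.2 ⟨hf₂, hfF⟩⟩),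
              Function.update_of_ne hf₁]
          · rw [A3InactiveTyped.flipOn_of_notMem hfF,
              A3InactiveTyped.flipOn_of_notMem (fun h => hfF
                (Finset.mem_of_mem_erase (Finset.mem_of_mem_erase h))), Function.update_of_ne hf₁]
      rw [hupd]
  -- the counting
  unfold pairCount
  rw [sum_admissible_split h₂F, ← hF', ← hz']
  have hstep : ∀ y₁ : Config E,
      (if (∀ f, f ∉ F' → y₁ f = z' f) then
        foldK ends a₁ a₂ b o (Function.update y₁ e₂ false)
            (A3InactiveTyped.flipOn F (Function.update y₁ e₂ false)) +
          foldK ends a₁ a₂ b o (Function.update y₁ e₂ true)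
            (A3InactiveTyped.flipOn F (Function.update y₁ e₂ true)) else (0 : R)) =
      (if (∀ f, f ∉ F' → y₁ f = z' f) then
        foldK ends' a₁ a₂ b o y₁ (A3InactiveTyped.flipOn F' y₁) else 0) +
      (if (∀ f, f ∉ F' → y₁ f = z' f) then
        foldK ends a₁ a₂ b o (Function.update y₁ e₁ false)
          (A3InactiveTyped.flipOn F'' (Function.update y₁ e₁ false)) else 0) := by
    intro y₁
    by_cases hadm : ∀ f, f ∉ F' → y₁ f = z' f
    · rw [if_pos hadm, if_pos hadm, if_pos hadm]
      have hy₁₂ : y₁ e₂ = false := by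
        have := hadm e₂ (Finset.notMem_erase e₂ F)
        rwa [hz', Function.update_self] at this
      have hm := hmono y₁ hy₁₂
      by_cases hy₁₁ : y₁ e₁ = false
      · rw [hy₁₁] at hm
        rw [hm, hmixF y₁ hy₁₂ hy₁₁]
      · have hy₁₁' : y₁ e₁ = true := by simpa using hy₁₁
        rw [hy₁₁'] at hm
        rw [hm, hmixT y₁ hy₁₂ hy₁₁', add_comm]
    · rw [if_neg hadm, if_neg hadm, if_neg hadm, add_zero]
  simp_rw [hstep]
  rw [Finset.sum_add_distrib]
  congr 1
  rw [sum_admissible_split h₁F', ← hF'', ← hz'', Finset.mul_sum]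
  refine Finset.sum_congr rfl fun y₂ _ => ?_
  by_cases hadm : ∀ f, f ∉ F'' → y₂ f = z'' f
  · rw [if_pos hadm, if_pos hadm]
    have hy₂₁ : y₂ e₁ = false := by
      have := hadm e₁ (Finset.notMem_erase e₁ F')
      rwa [hz'', Function.update_self] at this
    rw [Function.update_idem, Function.update_idem, ← hy₂₁, Function.update_eq_self, two_mul]
  · rw [if_neg hadm, if_neg hadm, mul_zero]

end Series

end TB14Cut

end Summit.Ventures.PercRepro2
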